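import Summits.Ventures.LatticeQCDFlow.Scoring.InfiniteVolumeIndependence2D
import HarnessLib

/-!
# The exact non-abelian area law in two dimensions, V-w: spatially separated replicas of a local measurement are independent — the exact `1/n` error bar

HONEST FRAMING: exact (Metropolis-corrected) sampling algorithms for lattice gauge theory;
figures of merit are autocorrelation/cost numbers at stated couplings and volumes; no
continuum-physics claim.

Venture `LatticeQCDFlow` (cell pub-lqcd), sub-topic `Scoring`; FANOUT row 5 (`s0-sun-a`), GEN-22.
NEW WORK of the cell (placement rule).  Part V-u (`InfiniteVolumeIndependence2D`): under the unique infinite-volume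
state `μ_β` of two-dimensional lattice Yang–Mills (every compact metrisable `G`, continuous `ρ`, real `β`) the link
variables of two blocks a column apart are independent.  Consequence for the statistics of a local measurement `F`
(bounded measurable cylinder observable, support over an `R × T` box) repeated at the lattice translates
`x_i = (−iD, 0)`, `i < n`, with spacing `D ≥ R + 1`:

* **`indepFun_translates_of_lt`** — the translates `F ∘ θ_{x_i}`, `F ∘ θ_{x_j}` (`i < j`) are INDEPENDENT under `μ_β`;
* `integral_comp_configShift_eq_of_mem_two` — each has the same mean `∫ F dμ_β` (translation invariance, part V-k);
* **`variance_sum_translates_eq`** — `Var_{μ_β}(Σ_{i<n} F ∘ θ_{x_i}) = n · Var_{μ_β}(F)`: THE VARIANCE OF THE SPATIAL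
  AVERAGE OF `n` SEPARATED REPLICAS IS EXACTLY `Var(F)/n` — in two dimensions spatially separated measurements of any
  local observable (plaquette, Wilson loop, smeared operator, …) are worth exactly `n` independent samples, at every
  coupling (the error-bar oracle behind the cell's `plaquette within 2σ of exact` acceptance test, for every `G`).

No `def`, nothing cited as a fact, 0 sorry.
-/

noncomputable section

open MeasureTheory ProbabilityTheory Function Finset Filter Topology
open Literature.MathematicalPhysics.QuantumFieldTheory
open Literature.MathematicalPhysics.QuantumLattice
open Summit.Ventures.LatticeQCDFlow.Theory2.Lattice
open Summit.Ventures.LatticeQCDFlow.Theory2.Lattice.TwoDim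

namespace Summit.Ventures.LatticeQCDFlow.Scoring

variable {G : Type*} [Group G] [TopologicalSpace G] [IsTopologicalGroup G]
  [CompactSpace G] [T2Space G] [SecondCountableTopology G] [MeasurableSpace G] [BorelSpace G] {N : ℕ}
  (ρ : G →* Matrix (Fin N) (Fin N) ℂ)

/-- **SEPARATED TRANSLATES OF A LOCAL OBSERVABLE ARE INDEPENDENT** under the infinite-volume two-dimensional
Yang–Mills state: `F` a measurable cylinder observable with support over the `R × T` box at `(a, b)`, spacing
`D ≥ R + 1`, translates `x_i = (−iD, 0)`; for `i < j` the observables `F ∘ θ_{x_i}` and `F ∘ θ_{x_j}` are independent. -/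
theorem indepFun_translates_of_lt (hρ : Continuous ρ) {β : ℝ} {μ : Measure (LGConfig 2 G)}
    (hμ : μ ∈ infiniteVolumeLimitPoints ρ β) {F : LGConfig 2 G → ℝ}
    {S : Finset ((Literature.MathematicalPhysics.QuantumLattice.ZdEdge 2))} (hF : IsCylinder F S) (hm : Measurable F)
    {a b : ℤ} {R T : ℕ}
    (hS : ∀ s ∈ S, s.1 ∈ (range R ×ˢ range T).image
      (fun q : ℕ × ℕ => (![a + q.1, b + q.2] : (Literature.Probability.LatticeModels.Site 2))))
    {D : ℕ} (hD : R + 1 ≤ D) {i j : ℕ} (hij : i < j) :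
    IndepFun (F ∘ configShift (![-((i : ℤ) * D), 0] : (Literature.Probability.LatticeModels.Site 2)))
      (F ∘ configShift (![-((j : ℤ) * D), 0] : (Literature.Probability.LatticeModels.Site 2))) μ := by
  set xi : (Literature.Probability.LatticeModels.Site 2) := ![-((i : ℤ) * D), 0] with hxi
  set xj : (Literature.Probability.LatticeModels.Site 2) := ![-((j : ℤ) * D), 0] with hxj
  have hFi := IsCylinder.comp_configShift hF xi
  have hFj := IsCylinder.comp_configShift hF xj
  have hSi := sites_image_shift_sub hS xi
  have hSj := sites_image_shift_sub hS xj
  have hmi : Measurable (F ∘ configShift xi) := hm.comp (configShift xi).measurable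
  have hmj : Measurable (F ∘ configShift xj) := hm.comp (configShift xj).measurable
  have hgap : a - xi 0 + R + 1 ≤ a - xj 0 := by
    have h1 : i * D + D ≤ j * D := by
      have := Nat.mul_le_mul_right D (Nat.succ_le_of_lt hij)
      rw [Nat.succ_mul] at this
      exact this
    have h2 : ((i : ℤ) * D + D : ℤ) ≤ (j : ℤ) * D := by exact_mod_cast h1
    simp only [hxi, hxj, Matrix.cons_val_zero]
    omega
  exact indepFun_of_cylinder (indepFun_restrict_of_col_sep ρ hρ hμ hSi hSj hgap) hFi hFj hmi hmj

/-- Translates of a local observable have the same infinite-volume expectation (translation invariance, part V-k). -/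
theorem integral_comp_configShift_eq_of_mem_two (hρ : Continuous ρ) {β : ℝ} {μ : Measure (LGConfig 2 G)}
    (hμ : μ ∈ infiniteVolumeLimitPoints ρ β) (F : LGConfig 2 G → ℝ)
    (x : (Literature.Probability.LatticeModels.Site 2)) :
    ∫ U, (F ∘ configShift x) U ∂μ = ∫ U, F U ∂μ := by
  have hinv := isZdTranslationInvariant_of_mem_two ρ hρ hμ x
  conv_rhs => rw [← hinv]
  rw [integral_map_equiv (configShift x) F]
  rfl

/-- Translates of a local observable have the same infinite-volume variance. -/
theorem variance_comp_configShift_eq_of_mem_two (hρ : Continuous ρ) {β : ℝ} {μ : Measure (LGConfig 2 G)}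
    (hμ : μ ∈ infiniteVolumeLimitPoints ρ β) (F : LGConfig 2 G → ℝ)
    (x : (Literature.Probability.LatticeModels.Site 2)) :
    Var[F ∘ configShift x; μ] = Var[F; μ] := by
  have hinv := isZdTranslationInvariant_of_mem_two ρ hρ hμ x
  rw [← variance_map_equiv F (configShift x), hinv]

/-- **THE EXACT `1/n` ERROR BAR: THE VARIANCE OF `n` SEPARATED REPLICAS IS ADDITIVE.**  With `F`, `D`, `x_i` as in
`indepFun_translates_of_lt` and `F` bounded: `Var_{μ_β}(Σ_{i<n} F ∘ θ_{x_i}) = n · Var_{μ_β}(F)` for every `n`, so the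
spatial average of `n` separated replicas has variance exactly `Var(F)/n` — every compact metrisable `G`, every
continuous `ρ`, EVERY real `β`. -/
theorem variance_sum_translates_eq (hρ : Continuous ρ) {β : ℝ} {μ : Measure (LGConfig 2 G)}
    (hμ : μ ∈ infiniteVolumeLimitPoints ρ β) {F : LGConfig 2 G → ℝ}
    {S : Finset ((Literature.MathematicalPhysics.QuantumLattice.ZdEdge 2))} (hF : IsCylinder F S) (hm : Measurable F)
    {C : ℝ} (hb : ∀ U, |F U| ≤ C) {a b : ℤ} {R T : ℕ}
    (hS : ∀ s ∈ S, s.1 ∈ (range R ×ˢ range T).image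
      (fun q : ℕ × ℕ => (![a + q.1, b + q.2] : (Literature.Probability.LatticeModels.Site 2))))
    {D : ℕ} (hD : R + 1 ≤ D) (n : ℕ) :
    Var[∑ i ∈ range n, F ∘ configShift (![-((i : ℤ) * D), 0] : (Literature.Probability.LatticeModels.Site 2)); μ] =
      n * Var[F; μ] := by
  obtain ⟨μ₀, hprob, -, huniq, -, -⟩ := exists_infiniteVolumeLimit_two ρ hρ β
  have hμ' := hμ
  rw [huniq, Set.mem_singleton_iff] at hμ'
  subst hμ'
  have hmi : ∀ i : ℕ, Measurable (F ∘ configShift (![-((i : ℤ) * D), 0] : (Literature.Probability.LatticeModels.Site 2))) :=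
    fun i => hm.comp (configShift _).measurable
  have hL2 : ∀ i ∈ range n,
      MemLp (F ∘ configShift (![-((i : ℤ) * D), 0] : (Literature.Probability.LatticeModels.Site 2))) 2 μ :=
    fun i _ => MemLp.of_bound (hmi i).aestronglyMeasurable C (ae_of_all _ fun U => by
      simpa [Real.norm_eq_abs] using hb _)
  have hpair : Set.Pairwise (↑(range n) : Set ℕ) fun i j =>
      IndepFun (F ∘ configShift (![-((i : ℤ) * D), 0] : (Literature.Probability.LatticeModels.Site 2)))
        (F ∘ configShift (![-((j : ℤ) * D), 0] : (Literature.Probability.LatticeModels.Site 2))) μ := by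
    intro i _ j _ hij
    rcases lt_or_gt_of_ne hij with h | h
    · exact indepFun_translates_of_lt ρ hρ hμ hF hm hS hD h
    · exact (indepFun_translates_of_lt ρ hρ hμ hF hm hS hD h).symm
  rw [IndepFun.variance_sum hL2 hpair]
  simp_rw [variance_comp_configShift_eq_of_mem_two ρ hρ hμ F]
  rw [Finset.sum_const, Finset.card_range, nsmul_eq_mul]

end Summit.Ventures.LatticeQCDFlow.Scoring
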